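import Literature.NumberTheory.LFunctions.ZetaMulMeanValue
import Literature.NumberTheory.LFunctions.SiegelProductCoefficients
import Literature.NumberTheory.LFunctions.ZetaRealAxis
import Mathlib.NumberTheory.Harmonic.ZetaAsymp
import HarnessLib

/-!
# The Abel transform of `ζ(s) L(s, χ) − L(1, χ) ζ(s)` on `Re s > 1/2` and its value at a real zero

Topic `Literature/NumberTheory/LFunctions`. Everything in this file is PROVED.

Let `χ ≠ 1` be a quadratic character mod `q`, `r = ζ ⋆ χ ≥ 0`, `S₀(N) = ∑_{n ≤ N} r(n)` and
`E(N) = S₀(N) − N L(1, χ)`, so that `|E(N)| ≤ 5q√N` (`ZetaMulMeanValue.lean`). The Abel transform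
`Ψ_χ(s) = ∑_{n ≥ 1} E(n) (n^{-s} − (n+1)^{-s})` is a locally uniformly convergent series of entire
functions on `Re s > 1/2` (Weierstrass), and for `Re s > 1` partial summation of the two
absolutely convergent Dirichlet series `∑ r(n) n^{-s} = ζ(s) L(s, χ)` (tree
`SiegelCoefficients.LSeries_zetaMul_eq`) and `∑ n^{-s} = ζ(s)` gives
`Ψ_χ(s) = ζ(s) (L(s, χ) − L(1, χ))`. The right-hand side is the entire function
`ζ₁(s) · (L(s, χ) − L(1, χ))/(s − 1)` (Mathlib's `riemannZeta₁`, `ζ(s) = ζ₁(s)/(s−1)`, and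
`dslope`), so the identity theorem on the half-plane `Re s > 1/2` gives, at a REAL ZERO
`β ∈ (1/2, 1)` of `L(s, χ)`:

  `Ψ_χ(β) = −ζ(β) L(1, χ) ≥ (β/(1 − β)) · L(1, χ)`

(`ζ(β) ≤ β/(β − 1) < 0` on `(0, 1)`, Titchmarsh (2.1.4), tree `ZetaRealAxis.lean`; `L(1, χ) > 0`).
This is the analytic heart of the tree's proof of Motohashi's theorem on the Brun–Titchmarsh
constant and Siegel zeros (`Literature/Barriers/Parity/BrunTitchmarshSiegelZero.lean`): the harmonic
sums `∑_{n ≤ z} r(n)/n` dominate `Ψ_χ(β)`, hence are `≫ L(1,χ)/(1 − β)` (`ZetaMulHarmonicSum.lean`).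

Main statements (namespace `Literature.NumberTheory.LFunctions.ZetaMul`):
* `err χ N = S₀(N) − N L(1,χ)`, `abs_err_le`;
* `psi χ s = Ψ_χ(s)`, `differentiableOn_psi` (on `Re s > 1/2`), `psi_eq_of_one_lt`
  (`= ζ(s)(L(s,χ) − L(1,χ))` on `Re s > 1`), `psi_eq` (`= ζ₁(s) · dslope L(·,χ) 1 s` on `Re s > 1/2`);
* `psi_ofReal_eq_of_LFunction_eq_zero` (`Ψ_χ(β) = −ζ(β) L(1,χ)`), `re_psi_ofReal_ge`;
* `exists_hasSum_err_mul_ge` — the real-series export used downstream: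
  `∑_{n ≥ 1} E(n)(n^{-β} − (n+1)^{-β}) = Ψ ≥ (β/(1−β)) L(1,χ)`.

## References

* H. L. Montgomery, R. C. Vaughan, *Multiplicative Number Theory I*, CUP 2007, §1.3 Thm. 1.3
  (partial summation), §4.3 Thm. 4.8. [cite: MontgomeryVaughan2007, §1.3 Thm. 1.3]
* E. C. Titchmarsh, *The Theory of the Riemann Zeta-Function*, 2nd ed., §2.1 (2.1.4) (`ζ` on the
  real axis; tree `ZetaRealAxis.lean`). [cite: Titchmarsh1986, §2.1 eq. (2.1.4)]
* Y. Motohashi, *A note on Siegel's zeros*, Proc. Japan Acad. 55A (1979) 190–192 (the theorem this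
  serves; the device of comparing `∑ r(n) n^{-s}` at the zero with the harmonic sums is the tree's
  rendering of his step (3)). [cite: Motohashi1979SiegelZeros, proof of the Theorem, (3)]
-/

noncomputable section

open Complex Filter Topology Finset
open scoped ComplexOrder

namespace Literature.NumberTheory.LFunctions.ZetaMul

open DirichletAbel

variable {q : ℕ} [NeZero q] (χ : DirichletCharacter ℂ q)

/-! ### The error term `E(N) = S₀(N) − N L(1, χ)` -/

/-- `E(N) = ∑_{n ≤ N} r(n) − N L(1, χ)` (real). [folklore] -/
def err (N : ℕ) : ℝ := convSum χ N - N * LOne χ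

/-- `|E(N)| ≤ 5 q √N` (`abs_convSum_sub_le`). [cite: MontgomeryVaughan2007, §2.1 eq. (2.9); §4.3 (4.23)] -/
theorem abs_err_le (hχ : χ ≠ 1) (hq : χ ^ 2 = 1) (N : ℕ) : |err χ N| ≤ 5 * q * Real.sqrt N :=
  abs_convSum_sub_le χ hχ hq N

/-- `|E(N)| ≤ 5 q N^{1/2}` in `rpow` form. [folklore] -/
theorem abs_err_le_rpow (hχ : χ ≠ 1) (hq : χ ^ 2 = 1) (N : ℕ) :
    |err χ N| ≤ 5 * q * (N : ℝ) ^ (1 / 2 : ℝ) := by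
  rw [← Real.sqrt_eq_rpow]; exact abs_err_le χ hχ hq N

/-! ### Partial sums of absolutely convergent Dirichlet series -/

omit [NeZero q] in
/-- For an `L`-series summable at `s`, `∑_{0 < m ≤ M} f(m) m^{-s} → L(f, s)`. [folklore] -/
theorem tendsto_sum_Ioc_mul_cpow_of_LSeriesSummable {f : ℕ → ℂ} {s : ℂ} (hf : LSeriesSummable f s) :
    Tendsto (fun M : ℕ => ∑ m ∈ Ioc 0 M, f m * (m : ℂ) ^ (-s)) atTop (𝓝 (LSeries f s)) := by
  have h1 := hf.hasSum.tendsto_sum_nat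
  have h2 := h1.comp (tendsto_add_atTop_nat 1)
  refine h2.congr fun M => ?_
  simp only [Function.comp_apply]
  induction M with
  | zero => simp [LSeries.term_def]
  | succ M ih =>
    rw [Finset.sum_range_succ, ih, Finset.sum_Ioc_succ_top (Nat.zero_le M)]
    congr 1
    rw [LSeries.term_def, if_neg (Nat.succ_ne_zero M), cpow_neg, div_eq_mul_inv]

omit [NeZero q] in
/-- `∑_{0 < m ≤ M} m^{-s} → ζ(s)` for `Re s > 1`. [folklore] -/
theorem tendsto_sum_Ioc_cpow_zeta {s : ℂ} (hs : 1 < s.re) :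
    Tendsto (fun M : ℕ => ∑ m ∈ Ioc 0 M, (m : ℂ) ^ (-s)) atTop (𝓝 (riemannZeta s)) := by
  have h := tendsto_sum_Ioc_mul_cpow_of_LSeriesSummable
    (ArithmeticFunction.LSeriesSummable_zeta_iff.mpr hs)
  rw [ArithmeticFunction.LSeries_zeta_eq_riemannZeta hs] at h
  refine h.congr fun M => Finset.sum_congr rfl fun m hm => ?_
  have hm0 : m ≠ 0 := Nat.pos_iff_ne_zero.mp (Finset.mem_Ioc.mp hm).1
  simp [ArithmeticFunction.zeta_apply_ne hm0]

omit [NeZero q] in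
/-- `(M+1)^{1 − σ} → 0` for `σ > 1`, in the form `(M + 1) (M+1)^{-σ} → 0`. [folklore] -/
theorem tendsto_succ_mul_rpow_neg {σ : ℝ} (hσ : 1 < σ) :
    Tendsto (fun M : ℕ => ((M + 1 : ℕ) : ℝ) * ((M + 1 : ℕ) : ℝ) ^ (-σ)) atTop (𝓝 0) := by
  have h1 : Tendsto (fun M : ℕ => ((M + 1 : ℕ) : ℝ)) atTop atTop :=
    tendsto_natCast_atTop_atTop.comp (tendsto_add_atTop_nat 1)
  have h2 := (tendsto_rpow_neg_atTop (y := σ - 1) (by linarith)).comp h1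
  refine h2.congr fun M => ?_
  have hM : (0 : ℝ) < ((M + 1 : ℕ) : ℝ) := by positivity
  simp only [Function.comp_apply]
  rw [show (-(σ - 1) : ℝ) = 1 + -σ by ring, Real.rpow_add hM, Real.rpow_one]

/-- Abel summation in range form: for coefficients `c` with partial sums `C(k) = ∑_{0<j≤k} c_j`,
`∑_{n<M} C(n+1)((n+1)^{-s} − (n+2)^{-s}) = ∑_{0<k≤M} c_k k^{-s} − C(M)(M+1)^{-s}`. [cite: MontgomeryVaughan2007, §1.3 Thm. 1.3] -/
theorem sum_range_partial_mul_sub_cpow (c : ℕ → ℂ) (s : ℂ) (M : ℕ) :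
    ∑ n ∈ range M, (∑ j ∈ Ioc 0 (n + 1), c j) *
        (((n + 1 : ℕ) : ℂ) ^ (-s) - ((n + 1 + 1 : ℕ) : ℂ) ^ (-s)) =
      ∑ k ∈ Ioc 0 M, c k * (k : ℂ) ^ (-s) - (∑ j ∈ Ioc 0 M, c j) * ((M + 1 : ℕ) : ℂ) ^ (-s) := by
  have hre : ∑ k ∈ Ioc 0 M, (∑ j ∈ Ioc 0 k, c j) * ((k : ℂ) ^ (-s) - ((k + 1 : ℕ) : ℂ) ^ (-s)) =
      ∑ n ∈ range M, (∑ j ∈ Ioc 0 (n + 1), c j) *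
        (((n + 1 : ℕ) : ℂ) ^ (-s) - ((n + 1 + 1 : ℕ) : ℂ) ^ (-s)) := by
    induction M with
    | zero => simp
    | succ M ih => rw [Finset.sum_Ioc_succ_top (Nat.zero_le M), ih, Finset.sum_range_succ]
  have h := sum_Ioc_mul_eq_abel c (fun k => (k : ℂ) ^ (-s)) 0 M
  rw [← hre]
  simp only [Nat.cast_add, Nat.cast_one] at h ⊢
  rw [h]
  ring

/-! ### The Abel transform `Ψ_χ` -/

/-- The `n`-th term `E(n+1) ((n+1)^{-s} − (n+2)^{-s})` of `Ψ_χ`. [folklore] -/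
def psiTerm (n : ℕ) (s : ℂ) : ℂ :=
  (err χ (n + 1) : ℂ) * (((n + 1 : ℕ) : ℂ) ^ (-s) - ((n + 1 + 1 : ℕ) : ℂ) ^ (-s))

/-- `Ψ_χ(s) = ∑_{n ≥ 1} E(n) (n^{-s} − (n+1)^{-s})`. [cite: MontgomeryVaughan2007, §1.3 Thm. 1.3] -/
def psi (s : ℂ) : ℂ := ∑' n : ℕ, psiTerm χ n s

/-- Each term of `Ψ_χ` is entire. [folklore] -/
theorem differentiable_psiTerm (n : ℕ) : Differentiable ℂ (psiTerm χ n) := by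
  intro s
  unfold psiTerm
  refine (DifferentiableAt.sub ?_ ?_).const_mul _
  · exact differentiableAt_id.neg.const_cpow (Or.inl (by exact_mod_cast Nat.succ_ne_zero n))
  · exact differentiableAt_id.neg.const_cpow (Or.inl (by exact_mod_cast Nat.succ_ne_zero (n + 1)))

/-- `‖psiTerm n s‖ ≤ 5 q ‖s‖ (n+1)^{-σ-1/2}` for `σ = Re s > 0` (from `|E(n+1)| ≤ 5q (n+1)^{1/2}` and
`‖(n+1)^{-s} − (n+2)^{-s}‖ ≤ ‖s‖ (n+1)^{-σ-1}`). [folklore] -/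
theorem norm_psiTerm_le (hχ : χ ≠ 1) (hq : χ ^ 2 = 1) (n : ℕ) {s : ℂ} (hs : 0 < s.re) :
    ‖psiTerm χ n s‖ ≤ 5 * q * ‖s‖ * ((n + 1 : ℕ) : ℝ) ^ (-s.re - 1 / 2) := by
  unfold psiTerm
  rw [norm_mul, Complex.norm_real, Real.norm_eq_abs]
  have hn : (0 : ℝ) < ((n + 1 : ℕ) : ℝ) := by positivity
  have h1 := abs_err_le_rpow χ hχ hq (n + 1)
  have h2 := MertensDictionary.norm_cpow_neg_sub_le (n := n + 1) (by omega) hs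
  calc |err χ (n + 1)| * ‖((n + 1 : ℕ) : ℂ) ^ (-s) - ((n + 1 + 1 : ℕ) : ℂ) ^ (-s)‖
      ≤ (5 * q * ((n + 1 : ℕ) : ℝ) ^ (1 / 2 : ℝ)) * (‖s‖ * ((n + 1 : ℕ) : ℝ) ^ (-s.re - 1)) :=
        mul_le_mul h1 h2 (norm_nonneg _) (by positivity)
    _ = 5 * q * ‖s‖ * (((n + 1 : ℕ) : ℝ) ^ (1 / 2 : ℝ) * ((n + 1 : ℕ) : ℝ) ^ (-s.re - 1)) := by ring
    _ = 5 * q * ‖s‖ * ((n + 1 : ℕ) : ℝ) ^ (-s.re - 1 / 2) := by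
        rw [← Real.rpow_add hn]; congr 2; ring

omit [NeZero q] χ in
/-- Summability of `∑ (n+1)^{-σ-1/2}` for `σ > 1/2`. [folklore] -/
theorem summable_rpow_neg_half {σ : ℝ} (hσ : 1 / 2 < σ) :
    Summable fun n : ℕ => ((n + 1 : ℕ) : ℝ) ^ (-σ - 1 / 2) :=
  (summable_nat_add_iff 1).mpr (Real.summable_nat_rpow.mpr (by linarith))

/-- Summability of the terms of `Ψ_χ` for `Re s > 1/2`. [folklore] -/
theorem summable_psiTerm (hχ : χ ≠ 1) (hq : χ ^ 2 = 1) {s : ℂ} (hs : 1 / 2 < s.re) :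
    Summable fun n => psiTerm χ n s :=
  Summable.of_norm_bounded (g := fun n : ℕ => 5 * q * ‖s‖ * ((n + 1 : ℕ) : ℝ) ^ (-s.re - 1 / 2))
    ((summable_rpow_neg_half hs).mul_left _) (fun n => norm_psiTerm_le χ hχ hq n (by linarith))

omit [NeZero q] χ in
/-- The half-plane `Re s > 1/2` is open. [folklore] -/
theorem isOpen_re_gt_half : IsOpen {s : ℂ | 1 / 2 < s.re} := isOpen_lt continuous_const continuous_re

/-- **`Ψ_χ` is holomorphic on `Re s > 1/2`** (Weierstrass `M`-test on `{σ₀ < Re s, ‖s‖ < R}`).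
[cite: MontgomeryVaughan2007, §1.3 Thm. 1.3] -/
theorem differentiableOn_psi (hχ : χ ≠ 1) (hq : χ ^ 2 = 1) :
    DifferentiableOn ℂ (psi χ) {s : ℂ | 1 / 2 < s.re} := by
  intro s hs
  simp only [Set.mem_setOf_eq] at hs
  set σ₀ : ℝ := (s.re + 1 / 2) / 2 with hσ₀
  have hσ₀' : 1 / 2 < σ₀ := by rw [hσ₀]; linarith
  set R : ℝ := ‖s‖ + 1 with hR
  set U : Set ℂ := {w : ℂ | σ₀ < w.re} ∩ {w : ℂ | ‖w‖ < R} with hU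
  have hUo : IsOpen U :=
    (isOpen_lt continuous_const Complex.continuous_re).inter (isOpen_lt continuous_norm continuous_const)
  have hsU : s ∈ U := ⟨by simp only [Set.mem_setOf_eq, hσ₀]; linarith, by simp [hR]⟩
  have hdiff : DifferentiableOn ℂ (psi χ) U := by
    refine differentiableOn_tsum_of_summable_norm
      (u := fun n : ℕ => 5 * q * R * ((n + 1 : ℕ) : ℝ) ^ (-σ₀ - 1 / 2)) ?_
      (fun n => (differentiable_psiTerm χ n).differentiableOn) hUo ?_
    · exact (summable_rpow_neg_half hσ₀').mul_left _
    · intro n w hw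
      obtain ⟨hw1, hw2⟩ := hw
      simp only [Set.mem_setOf_eq] at hw1 hw2
      have hw0 : 0 < w.re := by linarith
      refine (norm_psiTerm_le χ hχ hq n hw0).trans ?_
      have h1 : (1 : ℝ) ≤ ((n + 1 : ℕ) : ℝ) := by exact_mod_cast Nat.le_add_left 1 n
      have : ((n + 1 : ℕ) : ℝ) ^ (-w.re - 1 / 2) ≤ ((n + 1 : ℕ) : ℝ) ^ (-σ₀ - 1 / 2) :=
        Real.rpow_le_rpow_of_exponent_le h1 (by linarith)
      exact mul_le_mul (mul_le_mul_of_nonneg_left hw2.le (by positivity)) this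
        (by positivity) (by positivity)
  exact (hdiff.differentiableAt (hUo.mem_nhds hsU)).differentiableWithinAt

/-- Partial sums of `Ψ_χ(s)`: `∑_{n<M} psiTerm n s =
(∑_{k ≤ M} r(k)k^{-s} − S₀(M)(M+1)^{-s}) − L(1,χ) (∑_{k ≤ M} k^{-s} − M (M+1)^{-s})`
(Abel summation of the two Dirichlet series). [cite: MontgomeryVaughan2007, §1.3 Thm. 1.3] -/
theorem sum_range_psiTerm_eq (hq : χ ^ 2 = 1) (s : ℂ) (M : ℕ) :
    ∑ n ∈ range M, psiTerm χ n s =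
      (∑ k ∈ Ioc 0 M, χ.zetaMul k * (k : ℂ) ^ (-s) - (convSum χ M : ℂ) * ((M + 1 : ℕ) : ℂ) ^ (-s)) -
        (LOne χ : ℂ) * (∑ k ∈ Ioc 0 M, (k : ℂ) ^ (-s) - (M : ℂ) * ((M + 1 : ℕ) : ℂ) ^ (-s)) := by
  have hA := sum_range_partial_mul_sub_cpow (fun k => χ.zetaMul k) s M
  have hZ := sum_range_partial_mul_sub_cpow (fun _ => (1 : ℂ)) s M
  simp only [one_mul, Finset.sum_const, Nat.card_Ioc, Nat.sub_zero, nsmul_eq_mul, mul_one] at hZ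
  rw [← ofReal_convSum χ hq] at hA
  have hterm : ∀ n ∈ range M, psiTerm χ n s =
      (∑ j ∈ Ioc 0 (n + 1), χ.zetaMul j) * (((n + 1 : ℕ) : ℂ) ^ (-s) - ((n + 1 + 1 : ℕ) : ℂ) ^ (-s)) -
        (LOne χ : ℂ) * (((n + 1 : ℕ) : ℂ) *
          (((n + 1 : ℕ) : ℂ) ^ (-s) - ((n + 1 + 1 : ℕ) : ℂ) ^ (-s))) := by
    intro n _
    rw [psiTerm, err, ← ofReal_convSum χ hq]
    push_cast
    ring
  rw [Finset.sum_congr rfl hterm, Finset.sum_sub_distrib, ← Finset.mul_sum, hA, hZ]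

/-- **`Ψ_χ(s) = ζ(s) (L(s, χ) − L(1, χ))` for `Re s > 1`**: let `M → ∞` in `sum_range_psiTerm_eq`
(`∑ r(k) k^{-s} → ζ(s)L(s,χ)` by the tree's `SiegelCoefficients.LSeries_zetaMul_eq`,
`∑ k^{-s} → ζ(s)`, and the boundary terms are `O((M+1)^{1−σ}) → 0`).
[cite: MontgomeryVaughan2007, §1.3 Thm. 1.3] -/
theorem psi_eq_of_one_lt (hχ : χ ≠ 1) (hq : χ ^ 2 = 1) {s : ℂ} (hs : 1 < s.re) :
    psi χ s = riemannZeta s * (χ.LFunction s - χ.LFunction 1) := by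
  have hs0 : 0 < s.re := by linarith
  -- the four limits
  have hA : Tendsto (fun M : ℕ => ∑ k ∈ Ioc 0 M, χ.zetaMul k * (k : ℂ) ^ (-s)) atTop
      (𝓝 (riemannZeta s * χ.LFunction s)) := by
    rw [← SiegelCoefficients.LSeries_zetaMul_eq χ hs]
    exact tendsto_sum_Ioc_mul_cpow_of_LSeriesSummable (χ.LSeriesSummable_zetaMul hs)
  have hZ : Tendsto (fun M : ℕ => ∑ k ∈ Ioc 0 M, (k : ℂ) ^ (-s)) atTop (𝓝 (riemannZeta s)) :=
    tendsto_sum_Ioc_cpow_zeta hs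
  have hdecay := tendsto_succ_mul_rpow_neg hs
  have hB : Tendsto (fun M : ℕ => (convSum χ M : ℂ) * ((M + 1 : ℕ) : ℂ) ^ (-s)) atTop (𝓝 0) := by
    refine squeeze_zero_norm (a := fun M : ℕ => (LOne χ + 5 * q) *
      (((M + 1 : ℕ) : ℝ) * ((M + 1 : ℕ) : ℝ) ^ (-s.re))) (fun M => ?_) ?_
    · rw [norm_mul, Complex.norm_real, Complex.norm_natCast_cpow_of_pos (Nat.succ_pos M), neg_re,
        Real.norm_eq_abs, abs_of_nonneg (convSum_nonneg χ hq M)]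
      have hM1 : (M : ℝ) ≤ ((M + 1 : ℕ) : ℝ) := by exact_mod_cast Nat.le_succ M
      have hsq : Real.sqrt M ≤ ((M + 1 : ℕ) : ℝ) := by
        refine (Real.sqrt_le_sqrt hM1).trans ?_
        rw [Real.sqrt_le_left (by positivity)]
        have h1 : (1 : ℝ) ≤ ((M + 1 : ℕ) : ℝ) := by exact_mod_cast Nat.le_add_left 1 M
        nlinarith
      have hL := LOne_pos χ hχ hq
      have hconv : convSum χ M ≤ (LOne χ + 5 * q) * ((M + 1 : ℕ) : ℝ) := by
        have h := abs_convSum_sub_le χ hχ hq M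
        have h' : convSum χ M ≤ M * LOne χ + 5 * q * Real.sqrt M := by
          have := (abs_le.mp h).2; linarith
        have hq0 : (0 : ℝ) ≤ 5 * q := by positivity
        nlinarith [mul_le_mul_of_nonneg_left hsq hq0, mul_le_mul_of_nonneg_right hM1 hL.le]
      exact mul_le_mul_of_nonneg_right hconv (by positivity) |>.trans (le_of_eq (by ring))
    · simpa using hdecay.const_mul (LOne χ + 5 * q)
  have hD : Tendsto (fun M : ℕ => (M : ℂ) * ((M + 1 : ℕ) : ℂ) ^ (-s)) atTop (𝓝 0) := by
    refine squeeze_zero_norm (a := fun M : ℕ => ((M + 1 : ℕ) : ℝ) * ((M + 1 : ℕ) : ℝ) ^ (-s.re))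
      (fun M => ?_) hdecay
    rw [norm_mul, Complex.norm_natCast, Complex.norm_natCast_cpow_of_pos (Nat.succ_pos M), neg_re]
    have hM1 : (M : ℝ) ≤ ((M + 1 : ℕ) : ℝ) := by exact_mod_cast Nat.le_succ M
    exact mul_le_mul_of_nonneg_right hM1 (by positivity)
  -- assemble
  have hT : Tendsto (fun M => ∑ n ∈ range M, psiTerm χ n s) atTop (𝓝 (psi χ s)) :=
    (summable_psiTerm χ hχ hq (by linarith)).hasSum.tendsto_sum_nat
  have hlim : Tendsto (fun M => ∑ n ∈ range M, psiTerm χ n s) atTop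
      (𝓝 ((riemannZeta s * χ.LFunction s - 0) - (LOne χ : ℂ) * (riemannZeta s - 0))) := by
    refine ((hA.sub hB).sub ((hZ.sub hD).const_mul _)).congr fun M => ?_
    rw [sum_range_psiTerm_eq χ hq s M]
  have := tendsto_nhds_unique hT hlim
  rw [this, ofReal_LOne χ hχ hq]
  ring

/-- The right-hand side as an entire function: `ζ₁(s) · dslope L(·, χ) 1 (s)`, where
`ζ(s) = ζ₁(s)/(s − 1)` (Mathlib `riemannZeta₁`) and `dslope L 1 s = (L(s,χ) − L(1,χ))/(s − 1)`
off `s = 1`. [folklore] -/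
def psiRHS (s : ℂ) : ℂ := riemannZeta₁ s * dslope (fun w => χ.LFunction w) 1 s

/-- `psiRHS` is entire for `χ ≠ 1`. [folklore] -/
theorem differentiable_psiRHS (hχ : χ ≠ 1) : Differentiable ℂ (psiRHS χ) := by
  have hL : Differentiable ℂ (fun w => χ.LFunction w) := DirichletCharacter.differentiable_LFunction hχ
  have h := (differentiableOn_dslope (Filter.univ_mem : (Set.univ : Set ℂ) ∈ 𝓝 (1 : ℂ))).mpr
    hL.differentiableOn
  exact differentiable_riemannZeta₁.mul (differentiableOn_univ.mp h)

/-- Off `s = 1`, `psiRHS s = ζ(s) (L(s, χ) − L(1, χ))`. [folklore] -/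
theorem psiRHS_eq_of_ne_one {s : ℂ} (hs : s ≠ 1) :
    psiRHS χ s = riemannZeta s * (χ.LFunction s - χ.LFunction 1) := by
  rw [psiRHS, dslope_of_ne _ hs, slope_def_field, riemannZeta_eq_inv_sub_mul hs]
  have h1 : s - 1 ≠ 0 := sub_ne_zero.mpr hs
  field_simp

/-- **`Ψ_χ(s) = ζ₁(s) · dslope L(·,χ) 1 (s)` on `Re s > 1/2`** (identity theorem on the convex
half-plane: both sides are holomorphic there and agree on `Re s > 1`). [cite: MontgomeryVaughan2007, §1.3 Thm. 1.3] -/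
theorem psi_eq (hχ : χ ≠ 1) (hq : χ ^ 2 = 1) {s : ℂ} (hs : 1 / 2 < s.re) : psi χ s = psiRHS χ s := by
  set U : Set ℂ := {s : ℂ | 1 / 2 < s.re}
  have hU : IsPreconnected U := (convex_halfSpace_re_gt (1 / 2 : ℝ)).isPreconnected
  have hf : AnalyticOnNhd ℂ (psi χ) U := (differentiableOn_psi χ hχ hq).analyticOnNhd isOpen_re_gt_half
  have hg : AnalyticOnNhd ℂ (psiRHS χ) U :=
    (differentiable_psiRHS χ hχ).differentiableOn.analyticOnNhd isOpen_re_gt_half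
  have h2 : (2 : ℂ) ∈ U := by simp [U]; norm_num
  have hfg : psi χ =ᶠ[𝓝 (2 : ℂ)] psiRHS χ := by
    have hmem : {s : ℂ | 1 < s.re} ∈ 𝓝 (2 : ℂ) :=
      (isOpen_lt continuous_const continuous_re).mem_nhds (by simp)
    filter_upwards [hmem] with w hw
    have hw1 : w ≠ 1 := fun h => by simp [h] at hw
    rw [psi_eq_of_one_lt χ hχ hq hw, psiRHS_eq_of_ne_one χ hw1]
  exact hf.eqOn_of_preconnected_of_eventuallyEq hg hU h2 hfg hs

/-- **At a real zero `β ∈ (1/2, 1)` of `L(s, χ)`: `Ψ_χ(β) = −ζ(β) L(1, χ)`.**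
[cite: Motohashi1979SiegelZeros, proof of the Theorem, (3)] -/
theorem psi_ofReal_eq_of_LFunction_eq_zero (hχ : χ ≠ 1) (hq : χ ^ 2 = 1) {β : ℝ} (hβ : 1 / 2 < β)
    (hβ1 : β < 1) (h0 : χ.LFunction β = 0) :
    psi χ β = -(riemannZeta β * χ.LFunction 1) := by
  have hβ' : 1 / 2 < (β : ℂ).re := by simpa using hβ
  have hne : (β : ℂ) ≠ 1 := by
    intro h
    have := congrArg Complex.re h
    simp at this
    linarith
  rw [psi_eq χ hχ hq hβ', psiRHS_eq_of_ne_one χ hne, h0]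
  ring

/-- **The key inequality**: at a real zero `β ∈ (1/2, 1)`, `Re Ψ_χ(β) ≥ (β/(1 − β)) · L(1, χ)`
(`ζ(β)` is real with `ζ(β) ≤ β/(β − 1)`, Titchmarsh (2.1.4); `L(1,χ) > 0`).
[cite: Titchmarsh1986, §2.1 eq. (2.1.4)] [cite: Motohashi1979SiegelZeros, proof of the Theorem, (3)] -/
theorem re_psi_ofReal_ge (hχ : χ ≠ 1) (hq : χ ^ 2 = 1) {β : ℝ} (hβ : 1 / 2 < β) (hβ1 : β < 1)
    (h0 : χ.LFunction β = 0) :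
    β / (1 - β) * LOne χ ≤ (psi χ β).re := by
  have hβ0 : 0 < β := by linarith
  rw [psi_ofReal_eq_of_LFunction_eq_zero χ hχ hq hβ hβ1 h0, neg_re, mul_re,
    riemannZeta_im_eq_zero_of_pos hβ0 hβ1.ne, zero_mul, sub_zero, ← ofReal_LOne χ hχ hq, ofReal_re]
  have hζ := riemannZeta_ofReal_re_le_of_pos_of_lt_one hβ0 hβ1
  have hL := LOne_pos χ hχ hq
  have h1 : 0 < 1 - β := by linarith
  have : -(riemannZeta β).re ≥ β / (1 - β) := by
    have e : β / (β - 1) = -(β / (1 - β)) := by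
      rw [show β - 1 = -(1 - β) by ring, div_neg]
    linarith [e ▸ hζ]
  nlinarith

/-! ### The real-series export -/

/-- At real `s = β` the terms of `Ψ_χ` are the real numbers `E(n+1)((n+1)^{-β} − (n+2)^{-β})`. [folklore] -/
theorem psiTerm_ofReal (n : ℕ) (β : ℝ) :
    psiTerm χ n β =
      ((err χ (n + 1) * (((n + 1 : ℕ) : ℝ) ^ (-β) - ((n + 1 + 1 : ℕ) : ℝ) ^ (-β)) : ℝ) : ℂ) := by
  unfold psiTerm
  have h1 : ((n + 1 : ℕ) : ℂ) ^ (-(β : ℂ)) = ((((n + 1 : ℕ) : ℝ) ^ (-β) : ℝ) : ℂ) := by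
    rw [Complex.ofReal_cpow (by positivity), Complex.ofReal_natCast, Complex.ofReal_neg]
  have h2 : ((n + 1 + 1 : ℕ) : ℂ) ^ (-(β : ℂ)) = ((((n + 1 + 1 : ℕ) : ℝ) ^ (-β) : ℝ) : ℂ) := by
    rw [Complex.ofReal_cpow (by positivity), Complex.ofReal_natCast, Complex.ofReal_neg]
  rw [h1, h2]
  push_cast
  ring

/-- **Export (real form).** For a quadratic `χ ≠ 1` mod `q` and a real zero `β ∈ (1/2, 1)` of
`L(s, χ)`: the real series `∑_{n ≥ 1} E(n) (n^{-β} − (n+1)^{-β})`, `E(N) = ∑_{n ≤ N} r(n) − N L(1,χ)`,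
converges to a sum `Ψ ≥ (β/(1−β)) L(1, χ)`. This is the only statement of this file used downstream.
[cite: Motohashi1979SiegelZeros, proof of the Theorem, (3)] -/
theorem exists_hasSum_err_mul_ge (hχ : χ ≠ 1) (hq : χ ^ 2 = 1) {β : ℝ} (hβ : 1 / 2 < β)
    (hβ1 : β < 1) (h0 : χ.LFunction β = 0) :
    ∃ Ψ : ℝ, HasSum (fun n : ℕ => err χ (n + 1) *
        (((n + 1 : ℕ) : ℝ) ^ (-β) - ((n + 1 + 1 : ℕ) : ℝ) ^ (-β))) Ψ ∧
      β / (1 - β) * LOne χ ≤ Ψ := by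
  refine ⟨(psi χ β).re, ?_, re_psi_ofReal_ge χ hχ hq hβ hβ1 h0⟩
  have hs : 1 / 2 < (β : ℂ).re := by simpa using hβ
  have h := Complex.hasSum_re (summable_psiTerm χ hχ hq hs).hasSum
  refine h.congr_fun fun n => ?_
  rw [psiTerm_ofReal, ofReal_re]

end Literature.NumberTheory.LFunctions.ZetaMul

end
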